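import Mathlib
import HarnessLib
import Summits.CriticalPhenomena.CardyFormulaZ2.Theses.CardySelfDualSegment
import Literature.Probability.Percolation.CornerPercolation
import Literature.Barriers.CriticalPhenomena.EmbeddingModulusUniquenessProofs
import Literature.Probability.RandomPlanarGeometry.ConformalRectangleProofs
import Literature.Probability.RandomPlanarGeometry.CardyFunction
import Summits.CriticalPhenomena.CardyFormulaZ2.Theorems.CardySelfDualSegmentSegmentOpenStubCrossingProbPolynomial
import Summits.CriticalPhenomena.CardyFormulaZ2.Theorems.CardySelfDualSegmentSegmentOpenStubShearCrossRatioAnalytic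
import Summits.CriticalPhenomena.CardyFormulaZ2.Theorems.CardySelfDualSegmentSegmentOpenStubGoodSetUnivOfGlobalJets
import Summits.CriticalPhenomena.CardyFormulaZ2.Theorems.CardySelfDualSegmentSegmentOpenStubLocalComplexBound
import Summits.CriticalPhenomena.CardyFormulaZ2.Theorems.CardySelfDualSegmentUniformMarginalityWildFromRectilinear
import Summits.CriticalPhenomena.CardyFormulaZ2.Theorems.SegmentOpen.Negative.NormOne
import Summits.CriticalPhenomena.CardyFormulaZ2.Theorems.SegmentOpen.Negative.FrozenModulus

/-!
# Crux `SegmentOpen` (stmt-CriticalPhenomena-5471), line `Sketch` — reshape 8 (lead c6):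
# global jets over RECTILINEAR test domains suffice

Reshape 7 (lead c5) composed the crux from three research stubs S4w / JC / JI quantified over ALL
conformal rectangles.  The `UniformMarginality` line (stmt-5472, lead c2, cross-crux note of
2026-08-17) records that the `∀ R` forms are very probably FALSE over wild Jordan rectangles:
stacked comb gadgets hung on an arc make `∂_t P_t(R*, δ_k)` blow up like `h_k · π_k` at the
gadgets' own meshes `δ_k → 0` (with vanishing total variation, so equicontinuity survives) —
hence no mesh-uniform complex bound near `t₀ = 0` (Cauchy's estimate) and no convergence of the
first coefficient at `R*`.  Reshape 8 therefore restricts the three stubs to RECTILINEAR conformal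
rectangles (boundary covered by finitely many axis-parallel segments — the tame class of the tree's
`RectilinearSuffices` and of `HeatFlow.IsRectilinear`), which is what the Monte-Carlo test probes
(boxes) and all the route needs.  This file proves the glue:

* `GlobalJetsRect.cardyLimits_of_jetsAt` — the PER-RECTANGLE core of GJ (p134197): complex bounds,
  coefficient convergence and the jet identification AT ONE `R'` give the sheared Cardy limits of
  `R'` at every `t ∈ [0,1]` along the curve `α` (Vitali with jets + identity theorem, verbatim
  lead c5's argument with the hypotheses localised at `R'`);
* `stub_cardyModAt_of_globalJetsRect` (GJR, registered): S4wR → JCR → (JIR-property of `α`) →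
  `CardyMod t (α t)` for EVERY conformal rectangle — the rectilinear limits are upgraded to all test
  domains by the landed `HeatFlow.cardyLimit_of_rectilinear` (p137344: mixed rectilinear
  approximants with nested crude events + Radó continuity of the Cardy value);
* `jetCurve_pinned_rect` — any such curve is pinned: `α 0 = ζ`, `α 1 = i`, `‖α t‖ = 1`
  (`Negative/FrozenModulus`, `Negative/NormOne`);
* `russoBoundAt_of_localComplexBoundAt` (Cauchy's estimate at one rectangle) and
  `uniformMarginality_of_localComplexBoundRect_of_target` — S4wR ∧ Target ⊢ the route decl
  `UniformMarginality` (through `HeatFlow.uniformMarginality_of_rectilinear_of_target`, p137344).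

All stub statements enter as HYPOTHESES; nothing research-grade is claimed.
-/

noncomputable section

namespace Summit.CriticalPhenomena.CardyFormulaZ2.Theorems

open Literature.Probability Literature.Barriers.CriticalPhenomena
open Literature.Probability.RandomPlanarGeometry (ConformalRectangle ConformalEquiv MarkedDomain)
open Filter Set Topology MeasureTheory
open UpperHalfPlane (upperHalfPlaneSet)

namespace GlobalJetsRect

open GoodSetUnivOfGlobalJets

/-- **Per-rectangle core of GJ.**  Fix a conformal rectangle `R'`.  From mesh-uniform local complex
bounds of ITS crossing polynomials near every `t₀ ∈ [0,1]`, convergence of ITS coefficients, and a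
real-analytic curve `α : [0,1] → ℍ` whose sheared Cardy values `F(M(α s))` have those coefficient
limits as one-sided jets at `0` (for every real-analytic modulus function `M` of `R'`), the crude
`M_t`-crossing probabilities of `R'` converge, for every `t ∈ [0,1]` and every presentation
`(R, φ, x)` of the sheared rectangle `φ_{α t} R'`, to `F(crossRatio x)`.  (Lead c5's proof of
`cardyModAt_curve_of_globalJets`, with the three hypotheses used only at `R'`.) -/
theorem cardyLimits_of_jetsAt (R' : ConformalRectangle)
    (h4 : ∀ t₀ : unitInterval, ∃ r > 0, ∃ δ₁ > 0, ∃ C : ℝ, ∀ δ : ℝ, 0 < δ → δ < δ₁ →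
      ∀ p : Polynomial ℝ,
        (∀ t : unitInterval, Percolation.cornerCrossingProb t R' δ = p.eval (t : ℝ)) →
        ∀ z ∈ Metric.ball ((t₀ : ℝ) : ℂ) r, ‖(p.map (algebraMap ℝ ℂ)).eval z‖ ≤ C)
    (hJC : ∀ k : ℕ, ∃ a : ℝ, ∀ ε > 0, ∃ δ₀ > 0, ∀ δ : ℝ, 0 < δ → δ < δ₀ → ∀ p : Polynomial ℝ,
        (∀ t : unitInterval, Percolation.cornerCrossingProb t R' δ = p.eval (t : ℝ)) →
        |p.coeff k - a| < ε)
    {α : ℝ → ℂ} (hαan : AnalyticOnNhd ℝ α (Set.Icc 0 1)) (hαim : ∀ s ∈ Set.Icc (0 : ℝ) 1, 0 < (α s).im)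
    (hJ : ∀ M : ℂ → ℝ, AnalyticOnNhd ℝ M {β : ℂ | 0 < β.im} →
        (∀ β : ℂ, 0 < β.im → ∀ (R : ConformalRectangle)
            (φ : ConformalEquiv UpperHalfPlane.upperHalfPlaneSet R.carrier) (x : Fin 4 → ℝ),
            R.carrier = moduliShear β '' R'.carrier → (∀ i, R.pt i = moduliShear β (R'.pt i)) →
            R.IsUniformizing φ x → RandomPlanarGeometry.crossRatio x = M β) →
        ∀ a : ℕ → ℝ,
          (∀ k : ℕ, ∀ ε > 0, ∃ δ₀ > 0, ∀ δ : ℝ, 0 < δ → δ < δ₀ → ∀ p : Polynomial ℝ,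
              (∀ t : unitInterval, Percolation.cornerCrossingProb t R' δ = p.eval (t : ℝ)) →
              |p.coeff k - a k| < ε) →
          ∃ ε > 0, ∀ s : ℝ, 0 ≤ s → s < ε →
            HasSum (fun k : ℕ => a k * s ^ k) (RandomPlanarGeometry.cardyFunction (M (α s))))
    (t : unitInterval) (R : ConformalRectangle)
    (φ : ConformalEquiv UpperHalfPlane.upperHalfPlaneSet R.carrier) (x : Fin 4 → ℝ)
    (hcar : R.carrier = moduliShear (α t) '' R'.carrier)
    (hpt : ∀ i, R.pt i = moduliShear (α t) (R'.pt i)) (hunif : R.IsUniformizing φ x) :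
    Tendsto (Percolation.cornerCrossingProb t R') (𝓝[>] 0)
      (𝓝 (RandomPlanarGeometry.cardyFunction (RandomPlanarGeometry.crossRatio x))) := by
  classical
  -- adapted from Theorems/CardySelfDualSegmentSegmentOpenGlobalJetsCurve.lean (lead c5)
  have ht01 : (t : ℝ) ∈ Icc (0 : ℝ) 1 := t.2
  -- the modulus function of `R'` (S7)
  obtain ⟨M, hMan, hM⟩ := stub_shearCrossRatioAnalytic R'
  have hcr : RandomPlanarGeometry.crossRatio x = M (α t) :=
    hM (α t) (hαim _ ht01) R φ x hcar hpt hunif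
  have hM01 : ∀ β : ℂ, 0 < β.im → M β ∈ Ioo (0 : ℝ) 1 := fun β hβ => by
    obtain ⟨Q, ψ, y, hc, hp, hψ⟩ := exists_shear_presentation R' hβ.ne'
    rw [← hM β hβ Q ψ y hc hp hψ]
    exact ConformalRectangle.crossRatio_mem_Ioo_of_isUniformizing hψ
  -- crossing polynomials of `R'` (S1)
  set P : ℝ → Polynomial ℝ := fun δ =>
    if hδ : 0 < δ then Classical.choose (stub_crossingProbPolynomial R' δ hδ) else 0 with hP
  have hPspec : ∀ δ : ℝ, 0 < δ → ∀ s : unitInterval,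
      Percolation.cornerCrossingProb s R' δ = (P δ).eval (s : ℝ) := fun δ hδ => by
    simp only [hP, dif_pos hδ]
    exact Classical.choose_spec (stub_crossingProbPolynomial R' δ hδ)
  -- coefficient limits (JC at `R'`) and their identification near `0⁺` (JI at `R'`)
  choose a ha using hJC
  obtain ⟨ε, hε, hsum⟩ := hJ M hMan hM a ha
  -- the comparison function is real-analytic on `[0,1]`
  have hh : AnalyticOnNhd ℝ (fun s : ℝ => RandomPlanarGeometry.cardyFunction (M (α s)))
      (Icc 0 1) := by
    intro s hs
    have him := hαim s hs
    have h2 : AnalyticAt ℝ (fun s : ℝ => M (α s)) s := (hMan _ him).comp_of_eq (hαan s hs) rfl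
    exact (RandomPlanarGeometry.analyticOnNhd_cardyFunction_Ioo _ (hM01 _ him)).comp_of_eq h2 rfl
  rw [hcr]
  -- reduce to sequences of meshes
  rw [tendsto_iff_seq_tendsto]
  intro d hd
  have key := tendsto_eval_of_globalJets (P := P)
    (fun t₀ => by
      obtain ⟨r, hr, δ₁, hδ₁, C, hC⟩ := h4 t₀
      exact ⟨r, hr, δ₁, hδ₁, C, fun δ hδ hδ' z hz => hC δ hδ hδ' (P δ) (hPspec δ hδ) z hz⟩)
    (fun k e he => by
      obtain ⟨δ₀, hδ₀, h⟩ := ha k e he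
      exact ⟨δ₀, hδ₀, fun δ hδ hδ' => h δ hδ hδ' (P δ) (hPspec δ hδ)⟩)
    hh hε hsum hd t
  have hgood : ∀ᶠ n in atTop, 0 < d n := by
    have h1 : ∀ᶠ n in atTop, d n ∈ Ioi 0 := hd self_mem_nhdsWithin
    exact h1.mono fun n hn => hn
  refine key.congr' ?_
  filter_upwards [hgood] with n hn
  exact (hPspec (d n) hn t).symm

end GlobalJetsRect

open GlobalJetsRect in
/-- **GJR — global jets over RECTILINEAR test domains ⇒ the modulus curve is good everywhere.**
From S4wR (mesh-uniform local complex bounds of the crossing polynomials of every RECTILINEAR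
conformal rectangle), JCR (convergence of every coefficient, rectilinear rectangles) and the JIR
property of a real-analytic curve `α : [0,1] → ℍ` (the coefficient limits of every rectilinear
`R'` are the one-sided jets at `0` of `s ↦ F(M(α s))`), the corner model `M_t` has Cardy limits
after the shear `φ_{α t}` in EVERY conformal rectangle, for every `t ∈ [0,1]`: `CardyMod t (α t)`.
Rectilinear case: `cardyLimits_of_jetsAt`; general test domains: `HeatFlow.cardyLimit_of_rectilinear`
(p137344).  Registered glue stub of reshape 8 of line `Sketch`. -/
theorem stub_cardyModAt_of_globalJetsRect :
    (∀ (t₀ : unitInterval) (R : ConformalRectangle),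
      (∃ S : Finset (ℂ × ℂ), (∀ p ∈ S, p.1.re = p.2.re ∨ p.1.im = p.2.im) ∧
        frontier R.carrier ⊆ ⋃ p ∈ S, segment ℝ p.1 p.2) →
      ∃ r > 0, ∃ δ₁ > 0, ∃ C : ℝ, ∀ δ : ℝ, 0 < δ → δ < δ₁ → ∀ p : Polynomial ℝ,
        (∀ t : unitInterval, Percolation.cornerCrossingProb t R δ = p.eval (t : ℝ)) →
        ∀ z ∈ Metric.ball ((t₀ : ℝ) : ℂ) r, ‖(p.map (algebraMap ℝ ℂ)).eval z‖ ≤ C) →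
    (∀ R' : ConformalRectangle,
      (∃ S : Finset (ℂ × ℂ), (∀ p ∈ S, p.1.re = p.2.re ∨ p.1.im = p.2.im) ∧
        frontier R'.carrier ⊆ ⋃ p ∈ S, segment ℝ p.1 p.2) →
      ∀ k : ℕ, ∃ a : ℝ, ∀ ε > 0, ∃ δ₀ > 0, ∀ δ : ℝ, 0 < δ → δ < δ₀ → ∀ p : Polynomial ℝ,
        (∀ t : unitInterval, Percolation.cornerCrossingProb t R' δ = p.eval (t : ℝ)) →
        |p.coeff k - a| < ε) →
    ∀ α : ℝ → ℂ, AnalyticOnNhd ℝ α (Set.Icc 0 1) → (∀ s ∈ Set.Icc (0 : ℝ) 1, 0 < (α s).im) →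
      (∀ R' : ConformalRectangle,
        (∃ S : Finset (ℂ × ℂ), (∀ p ∈ S, p.1.re = p.2.re ∨ p.1.im = p.2.im) ∧
          frontier R'.carrier ⊆ ⋃ p ∈ S, segment ℝ p.1 p.2) →
        ∀ M : ℂ → ℝ, AnalyticOnNhd ℝ M {β : ℂ | 0 < β.im} →
          (∀ β : ℂ, 0 < β.im → ∀ (R : ConformalRectangle)
              (φ : ConformalEquiv UpperHalfPlane.upperHalfPlaneSet R.carrier) (x : Fin 4 → ℝ),
              R.carrier = moduliShear β '' R'.carrier → (∀ i, R.pt i = moduliShear β (R'.pt i)) →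
              R.IsUniformizing φ x → RandomPlanarGeometry.crossRatio x = M β) →
          ∀ a : ℕ → ℝ,
            (∀ k : ℕ, ∀ ε > 0, ∃ δ₀ > 0, ∀ δ : ℝ, 0 < δ → δ < δ₀ → ∀ p : Polynomial ℝ,
                (∀ t : unitInterval, Percolation.cornerCrossingProb t R' δ = p.eval (t : ℝ)) →
                |p.coeff k - a k| < ε) →
            ∃ ε > 0, ∀ s : ℝ, 0 ≤ s → s < ε →
              HasSum (fun k : ℕ => a k * s ^ k) (RandomPlanarGeometry.cardyFunction (M (α s)))) →
      ∀ (t : unitInterval) (R R' : ConformalRectangle)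
        (φ : ConformalEquiv UpperHalfPlane.upperHalfPlaneSet R.carrier) (x : Fin 4 → ℝ),
        R.carrier = moduliShear (α t) '' R'.carrier →
        (∀ i, R.pt i = moduliShear (α t) (R'.pt i)) → R.IsUniformizing φ x →
        Tendsto (Percolation.cornerCrossingProb t R') (𝓝[>] 0)
          (𝓝 (RandomPlanarGeometry.cardyFunction (RandomPlanarGeometry.crossRatio x))) := by
  intro h4 hJC α hαan hαim hJ t
  have ht01 : (t : ℝ) ∈ Icc (0 : ℝ) 1 := t.2
  -- rectilinear test domains: the per-rectangle core; then the landed rectilinear-to-wild upgrade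
  exact Summit.CriticalPhenomena.CardyFormulaZ2.Cruxes.UniformMarginality.HeatFlow.cardyLimit_of_rectilinear
    t (α t) (hαim _ ht01)
    (fun R R'' φ x hrect hcar hpt hunif =>
      cardyLimits_of_jetsAt R'' (fun t₀ => h4 t₀ R'' hrect) (hJC R'' hrect) hαan hαim
        (hJ R'' hrect) t R φ x hcar hpt hunif)

/-- **The rectilinear JI curve is pinned** (reshape-8 form of `jetCurve_pinned`, p135049): under
S4wR and JCR, any real-analytic curve `α : [0,1] → ℍ` with the rectilinear JI property satisfies
`α 0 = ζ = e^{iπ/3}`, `α 1 = i` and `‖α t‖ = 1` on `[0,1]` (the landed negative lemmas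
`modulus_zero_eq_triZeta`, `modulus_one_eq_I`, `norm_eq_one_of_cardyMod` applied to the good
moduli `α t` of `stub_cardyModAt_of_globalJetsRect`). -/
theorem jetCurve_pinned_rect
    (h4 : ∀ (t₀ : unitInterval) (R : ConformalRectangle),
      (∃ S : Finset (ℂ × ℂ), (∀ p ∈ S, p.1.re = p.2.re ∨ p.1.im = p.2.im) ∧
        frontier R.carrier ⊆ ⋃ p ∈ S, segment ℝ p.1 p.2) →
      ∃ r > 0, ∃ δ₁ > 0, ∃ C : ℝ, ∀ δ : ℝ, 0 < δ → δ < δ₁ → ∀ p : Polynomial ℝ,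
        (∀ t : unitInterval, Percolation.cornerCrossingProb t R δ = p.eval (t : ℝ)) →
        ∀ z ∈ Metric.ball ((t₀ : ℝ) : ℂ) r, ‖(p.map (algebraMap ℝ ℂ)).eval z‖ ≤ C)
    (hJC : ∀ R' : ConformalRectangle,
      (∃ S : Finset (ℂ × ℂ), (∀ p ∈ S, p.1.re = p.2.re ∨ p.1.im = p.2.im) ∧
        frontier R'.carrier ⊆ ⋃ p ∈ S, segment ℝ p.1 p.2) →
      ∀ k : ℕ, ∃ a : ℝ, ∀ ε > 0, ∃ δ₀ > 0, ∀ δ : ℝ, 0 < δ → δ < δ₀ → ∀ p : Polynomial ℝ,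
        (∀ t : unitInterval, Percolation.cornerCrossingProb t R' δ = p.eval (t : ℝ)) →
        |p.coeff k - a| < ε)
    {α : ℝ → ℂ} (hαan : AnalyticOnNhd ℝ α (Set.Icc 0 1))
    (hαim : ∀ s ∈ Set.Icc (0 : ℝ) 1, 0 < (α s).im)
    (hJ : ∀ R' : ConformalRectangle,
      (∃ S : Finset (ℂ × ℂ), (∀ p ∈ S, p.1.re = p.2.re ∨ p.1.im = p.2.im) ∧
        frontier R'.carrier ⊆ ⋃ p ∈ S, segment ℝ p.1 p.2) →
      ∀ M : ℂ → ℝ, AnalyticOnNhd ℝ M {β : ℂ | 0 < β.im} →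
        (∀ β : ℂ, 0 < β.im → ∀ (R : ConformalRectangle)
            (φ : ConformalEquiv UpperHalfPlane.upperHalfPlaneSet R.carrier) (x : Fin 4 → ℝ),
            R.carrier = moduliShear β '' R'.carrier → (∀ i, R.pt i = moduliShear β (R'.pt i)) →
            R.IsUniformizing φ x → RandomPlanarGeometry.crossRatio x = M β) →
        ∀ a : ℕ → ℝ,
          (∀ k : ℕ, ∀ ε > 0, ∃ δ₀ > 0, ∀ δ : ℝ, 0 < δ → δ < δ₀ → ∀ p : Polynomial ℝ,
              (∀ t : unitInterval, Percolation.cornerCrossingProb t R' δ = p.eval (t : ℝ)) →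
              |p.coeff k - a k| < ε) →
          ∃ ε > 0, ∀ s : ℝ, 0 ≤ s → s < ε →
            HasSum (fun k : ℕ => a k * s ^ k) (RandomPlanarGeometry.cardyFunction (M (α s)))) :
    α 0 = LatticeModels.triZeta ∧ α 1 = Complex.I ∧ ∀ t : unitInterval, ‖α t‖ = 1 := by
  -- adapted from `jetCurve_pinned` (Theorems/CardySelfDualSegmentSegmentOpenGlobalJetsCurve.lean)
  have hgood : ∀ t : unitInterval,
      SegmentOpen.Negative.CardyMod' (Percolation.cornerCrossingProb t) (α t) := fun t =>
    stub_cardyModAt_of_globalJetsRect h4 hJC α hαan hαim hJ t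
  refine ⟨?_, ?_, fun t => ?_⟩
  · have h := SegmentOpen.Negative.modulus_zero_eq_triZeta
      (hαim 0 (left_mem_Icc.2 zero_le_one)) (by simpa using hgood 0)
    simpa using h
  · have h := SegmentOpen.Negative.modulus_one_eq_I
      (hαim 1 (right_mem_Icc.2 zero_le_one)) (by simpa using hgood 1)
    simpa using h
  · exact SegmentOpen.Negative.norm_eq_one_of_cardyMod t (hαim _ t.2) (hgood t)

open LocalComplexBound
  Summit.CriticalPhenomena.CardyFormulaZ2.Cruxes.UniformMarginality.HeatFlow in
/-- **Cauchy's estimate at ONE rectangle** (the per-rectangle content of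
`russoBound_of_localComplexBound`, p134401): mesh-uniform local complex bounds of the crossing
polynomials of `R` near every `t₀ ∈ [0,1]` give `RussoBoundAt R` — `|∂_t P_t(R, δ)| ≤ C` locally
in `t`, uniformly in the mesh (small mesh: Cauchy; large mesh: `russoBound_largeMesh`). -/
theorem russoBoundAt_of_localComplexBoundAt (R : ConformalRectangle)
    (h : ∀ t₀ : unitInterval, ∃ r > 0, ∃ δ₁ > 0, ∃ C : ℝ, ∀ δ : ℝ, 0 < δ → δ < δ₁ →
      ∀ p : Polynomial ℝ,
        (∀ t : unitInterval, Percolation.cornerCrossingProb t R δ = p.eval (t : ℝ)) →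
        ∀ z ∈ Metric.ball ((t₀ : ℝ) : ℂ) r, ‖(p.map (algebraMap ℝ ℂ)).eval z‖ ≤ C) :
    RussoBoundAt R := by
  -- adapted from `russoBound_of_localComplexBound` (…SegmentOpenStubLocalComplexBound.lean)
  intro t₀ ht₀
  obtain ⟨r, hr, δ₁, hδ₁, C, hC⟩ := h ⟨t₀, ht₀⟩
  obtain ⟨C', hC'⟩ := russoBound_largeMesh R δ₁ hδ₁
  refine ⟨r / 2, half_pos hr, max (2 * C / (r / 2)) C', fun δ hδ t ht htt₀ => ?_⟩
  rcases lt_or_ge δ δ₁ with hlt | hle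
  · obtain ⟨p, hp⟩ := stub_crossingProbPolynomial R δ hδ
    rw [deriv_Pext_eq hp ht]
    exact (abs_derivative_eval_le hr (hC δ hδ hlt p hp) htt₀).trans (le_max_left _ _)
  · exact (hC' δ hle t ht).trans (le_max_right _ _)

open Summit.CriticalPhenomena.CardyFormulaZ2.Cruxes.UniformMarginality.HeatFlow in
/-- **S4wR ∧ Target ⊢ the route decl `UniformMarginality`.**  On rectilinear conformal rectangles
S4wR gives the Russo bound (`russoBoundAt_of_localComplexBoundAt`), hence the mesh-uniform modulus
of continuity (`integratedBoundAt_of`, p107176); the wild-domain half of the crux follows from the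
route's Target (`uniformMarginality_of_rectilinear_of_target`, p137344).  Reshape-8 form of the
census record "S4w ⊢ UM" (p134401): with the stubs restricted to tame domains the crux hypothesis
is no longer derivable from S4wR alone, but it is from S4wR and the line's own conclusion. -/
theorem uniformMarginality_of_localComplexBoundRect_of_target
    (h4 : ∀ (t₀ : unitInterval) (R : ConformalRectangle),
      (∃ S : Finset (ℂ × ℂ), (∀ p ∈ S, p.1.re = p.2.re ∨ p.1.im = p.2.im) ∧
        frontier R.carrier ⊆ ⋃ p ∈ S, segment ℝ p.1 p.2) →
      ∃ r > 0, ∃ δ₁ > 0, ∃ C : ℝ, ∀ δ : ℝ, 0 < δ → δ < δ₁ → ∀ p : Polynomial ℝ,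
        (∀ t : unitInterval, Percolation.cornerCrossingProb t R δ = p.eval (t : ℝ)) →
        ∀ z ∈ Metric.ball ((t₀ : ℝ) : ℂ) r, ‖(p.map (algebraMap ℝ ℂ)).eval z‖ ≤ C)
    (hT : Summit.CriticalPhenomena.CardyFormulaZ2.Theses.CardySelfDualSegment.Target) :
    Summit.CriticalPhenomena.CardyFormulaZ2.Theses.CardySelfDualSegment.UniformMarginality :=
  uniformMarginality_of_rectilinear_of_target
    (fun R hR => integratedBoundAt_of R
      (russoBoundAt_of_localComplexBoundAt R fun t₀ => h4 t₀ R hR)) hT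

end Summit.CriticalPhenomena.CardyFormulaZ2.Theorems
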